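import Literature.NumberTheory.LFunctions.LargeValuesAffineTools
import Literature.NumberTheory.LFunctions.LargeValuesSmoothedR
import Mathlib.Analysis.Distribution.SchwartzSpace.Fourier
import HarnessLib

/-!
# Sums over affine transformations, I: the majorant `g`, Plancherel, and the Fourier-side majorants (Guth–Maynard Lemma 9.2, eqs. (9.3)–(9.6))

Topic `NumberTheory/LFunctions`, family RH. Part of the programme around the tree's named fact
`Literature.NumberTheory.LFunctions.zeroDensity_guth_maynard` (L. Guth, J. Maynard, *New large value
estimates for Dirichlet polynomials*, Ann. of Math. 203 (2026)), reduced by `LargeValuesEnergyBound.lean`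
to Proposition 10.1, whose key input is Proposition 9.1 / Lemma 9.2 (§9, "Summing over affine
transformations"). This file sets up the objects of the proof of Lemma 9.2 and PROVES its first half:

* §1 the affine sum `affSum f I₁ I₂ M₃ u = ∑_{m₁∈I₁,m₂∈I₂,|m₃|≤M₃} f((m₁u+m₃)/m₂)`, the functional
  `Jfun f I₁ I₂ M₃ = ∫ (affSum)²` (the paper's `J(f)` for one choice of ranges), the smooth majorant
  `gfun` with the weight `ψ₁(m₃/M₃')` (eq. (9.3): `affSum ≤ gfun`, `Jfun ≤ ∫ gfun²`);
* §2 smoothness and compact support of `gfun`, and **Plancherel** `∫ gfun² = ∫ |ĝ|²` (eq. (9.4), Mathlib's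
  `SchwartzMap.integral_norm_sq_fourier`);
* §3 **the formula for `ĝ`** (eq. (9.5)): `ĝ(ξ) = ∑_{m₁,m₂} |m₂/m₁| f̂(m₂ξ/m₁) P_{m₁}(ξ)` with
  `P_{m₁}(ξ) = ∑_{m₃} ψ₁(m₃/M₃')e(m₃ξ/m₁) = ∑_ℓ M₃'ψ̂₁(M₃'(ℓ − ξ/m₁))` (Poisson), hence
  `|P_{m₁}(ξ)| ≤ perK(ξ/m₁)` and **eq. (9.6)**: `|ĝ(ξ)| ≤ ∑_{m₁} perK ψ̂₁ M₃' (ξ/m₁) · Φ_{m₁}(ξ)`,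
  `Φ_{m₁}(ξ) = |∑_{m₂} |m₂/m₁| f̂(m₂ξ/m₁)|` (`norm_fourier_gfun_le`), and the Cauchy–Schwarz consequence
  `|ĝ(ξ)|² ≤ S(ξ) · ∑_{m₁} perK(ξ/m₁) Φ_{m₁}(ξ)²` (`normSq_fourier_gfun_le`).

Definitions (with bodies): `affSum`, `Jfun`, `gfun`, `Pfun`, `Phifun`. No named fact is introduced;
everything in this file is proved.

## References

* L. Guth, J. Maynard, *New large value estimates for Dirichlet polynomials*, Ann. of Math. (2)
  203 (2026), no. 2; arXiv:2405.20552 (2024): §9, eqs. (9.1), (9.3)–(9.6), proof of Lemma 9.2.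
-/

noncomputable section

open Real Set Filter Topology Complex MeasureTheory Finset
open scoped FourierTransform ContDiff

namespace Literature.NumberTheory.LFunctions

namespace GuthMaynardAffine

open GuthMaynardFourier GuthMaynardS3 GuthMaynardSmoothR

/-! ## §1. The affine sum, `J(f)`, and the smooth majorant `g` -/

/-- The sum over affine transformations
`∑_{m₁∈I₁} ∑_{m₂∈I₂} ∑_{|m₃| ≤ M₃} f((m₁u + m₃)/m₂)`. [cite: GuthMaynard2026, (9.1)] -/
def affSum (f : ℝ → ℝ) (I₁ I₂ : Finset ℤ) (M₃ : ℕ) (u : ℝ) : ℝ :=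
  ∑ m₁ ∈ I₁, ∑ m₂ ∈ I₂, ∑ m₃ ∈ Finset.Icc (-(M₃ : ℤ)) M₃, f (((m₁ : ℝ) * u + m₃) / m₂)

/-- `J(f) = ∫ (∑ f((m₁u+m₃)/m₂))² du` for one choice of ranges. [cite: GuthMaynard2026, (9.1)] -/
def Jfun (f : ℝ → ℝ) (I₁ I₂ : Finset ℤ) (M₃ : ℕ) : ℝ := ∫ u, affSum f I₁ I₂ M₃ u ^ 2

/-- The smooth majorant `g(u) = ∑_{m₁,m₂} ∑_{m₃} ψ₁(m₃/M₃') f((m₁u+m₃)/m₂)` with `m₃` running over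
`|m₃| ≤ N₃` (`ψ₁(m₃/M₃')` majorises the condition `|m₃| ≤ M₃` when `M₃ ≤ 2M₃'`, and vanishes for
`|m₃| ≥ 3M₃'`). [cite: GuthMaynard2026, (9.3)] -/
def gfun (f : ℝ → ℝ) (I₁ I₂ : Finset ℤ) (M₃' : ℝ) (N₃ : ℕ) (u : ℝ) : ℝ :=
  ∑ m₁ ∈ I₁, ∑ m₂ ∈ I₂, ∑ m₃ ∈ Finset.Icc (-(N₃ : ℤ)) N₃, psi1 ((m₃ : ℝ) / M₃') * f (((m₁ : ℝ) * u + m₃) / m₂)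

section basic

variable {f : ℝ → ℝ} (hf0 : ∀ x, 0 ≤ f x)
include hf0

/-- `affSum ≥ 0` for `f ≥ 0`. [folklore] -/
theorem affSum_nonneg (I₁ I₂ : Finset ℤ) (M₃ : ℕ) (u : ℝ) : 0 ≤ affSum f I₁ I₂ M₃ u :=
  Finset.sum_nonneg fun _ _ ↦ Finset.sum_nonneg fun _ _ ↦ Finset.sum_nonneg fun _ _ ↦ hf0 _

/-- `gfun ≥ 0` for `f ≥ 0`. [folklore] -/
theorem gfun_nonneg (I₁ I₂ : Finset ℤ) (M₃' : ℝ) (N₃ : ℕ) (u : ℝ) : 0 ≤ gfun f I₁ I₂ M₃' N₃ u :=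
  Finset.sum_nonneg fun _ _ ↦ Finset.sum_nonneg fun _ _ ↦ Finset.sum_nonneg fun _ _ ↦
    mul_nonneg (psi1_nonneg _) (hf0 _)

/-- **Eq. (9.3): `affSum ≤ gfun`** when `M₃ ≤ 2M₃'`, `M₃' > 0` and `M₃ ≤ N₃`. [cite: GuthMaynard2026, (9.3)] -/
theorem affSum_le_gfun (I₁ I₂ : Finset ℤ) {M₃ N₃ : ℕ} {M₃' : ℝ} (hM₃' : 0 < M₃') (_hM : (M₃ : ℝ) ≤ 2 * M₃')
    (_hN : M₃ ≤ N₃) (u : ℝ) : affSum f I₁ I₂ M₃ u ≤ gfun f I₁ I₂ M₃' N₃ u := by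
  unfold affSum gfun
  refine Finset.sum_le_sum fun m₁ _ ↦ Finset.sum_le_sum fun m₂ _ ↦ ?_
  have hsub : Finset.Icc (-(M₃ : ℤ)) M₃ ⊆ Finset.Icc (-(N₃ : ℤ)) N₃ := by
    intro m hm; rw [Finset.mem_Icc] at hm ⊢; omega
  calc ∑ m₃ ∈ Finset.Icc (-(M₃ : ℤ)) M₃, f (((m₁ : ℝ) * u + m₃) / m₂)
      = ∑ m₃ ∈ Finset.Icc (-(M₃ : ℤ)) M₃, psi1 ((m₃ : ℝ) / M₃') * f (((m₁ : ℝ) * u + m₃) / m₂) := by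
        refine Finset.sum_congr rfl fun m₃ hm₃ ↦ ?_
        rw [psi1_eq_one, one_mul]
        rw [Finset.mem_Icc] at hm₃
        rw [abs_div, abs_of_pos hM₃', div_le_iff₀ hM₃']
        have : |(m₃ : ℝ)| ≤ M₃ := by
          rw [abs_le]; constructor <;> exact_mod_cast (by omega)
        linarith
    _ ≤ ∑ m₃ ∈ Finset.Icc (-(N₃ : ℤ)) N₃, psi1 ((m₃ : ℝ) / M₃') * f (((m₁ : ℝ) * u + m₃) / m₂) :=
        Finset.sum_le_sum_of_subset_of_nonneg hsub fun m₃ _ _ ↦ mul_nonneg (psi1_nonneg _) (hf0 _)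

end basic

/-! ## §2. Smoothness, support, Plancherel -/

section smooth

variable {f : ℝ → ℝ}

/-- `u ↦ f(au + b)` is smooth. [folklore] -/
theorem contDiff_comp_affine (hf : ContDiff ℝ ∞ f) (a b : ℝ) : ContDiff ℝ ∞ (fun u ↦ f (a * u + b)) :=
  hf.comp ((contDiff_const.mul contDiff_id).add contDiff_const)

/-- `u ↦ f(au + b)` has compact support (`a ≠ 0`). [folklore] -/
theorem hasCompactSupport_comp_affine (hfs : HasCompactSupport f) {a : ℝ} (ha : a ≠ 0) (b : ℝ) :
    HasCompactSupport (fun u ↦ f (a * u + b)) := by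
  refine (hfs.comp_homeomorph ((Homeomorph.mulLeft₀ a ha).trans (Homeomorph.addRight b))).mono ?_
  intro u hu
  simpa using hu

/-- `gfun` is smooth (all `m₂ ∈ I₂` non-zero is not even needed: `x/0 = 0`). [folklore] -/
theorem gfun_contDiff (hf : ContDiff ℝ ∞ f) (I₁ I₂ : Finset ℤ) (M₃' : ℝ) (N₃ : ℕ) :
    ContDiff ℝ ∞ (gfun f I₁ I₂ M₃' N₃) := by
  unfold gfun
  refine ContDiff.sum fun m₁ _ ↦ ContDiff.sum fun m₂ _ ↦ ContDiff.sum fun m₃ _ ↦ ?_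
  have e : (fun u : ℝ ↦ psi1 ((m₃ : ℝ) / M₃') * f (((m₁ : ℝ) * u + m₃) / m₂)) =
      fun u ↦ psi1 ((m₃ : ℝ) / M₃') * f (((m₁ : ℝ) / m₂) * u + (m₃ : ℝ) / m₂) := by
    ext u; congr 2; ring
  rw [e]
  exact contDiff_const.mul (contDiff_comp_affine hf _ _)

/-- Compact support of a finite sum of functions, pointwise form (Mathlib's
`HasCompactSupport.finset_sum` is stated for `∑ i ∈ s, F i` as a function). [folklore] -/
theorem hasCompactSupport_fun_sum {ι : Type*} {s : Finset ι} {F : ι → ℝ → ℝ}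
    (hF : ∀ i ∈ s, HasCompactSupport (F i)) : HasCompactSupport (fun x ↦ ∑ i ∈ s, F i x) := by
  have e : (fun x ↦ ∑ i ∈ s, F i x) = ∑ i ∈ s, F i := by
    ext x; simp only [Finset.sum_apply]
  rw [e]
  exact HasCompactSupport.finset_sum hF

/-- `gfun` has compact support if all `m₁ ∈ I₁` and `m₂ ∈ I₂` are non-zero. [folklore] -/
theorem hasCompactSupport_gfun (hfs : HasCompactSupport f) (I₁ I₂ : Finset ℤ) (hI₁ : ∀ m ∈ I₁, m ≠ 0)
    (hI₂ : ∀ m ∈ I₂, m ≠ 0) (M₃' : ℝ) (N₃ : ℕ) : HasCompactSupport (gfun f I₁ I₂ M₃' N₃) := by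
  unfold gfun
  refine hasCompactSupport_fun_sum fun m₁ hm₁ ↦ hasCompactSupport_fun_sum fun m₂ hm₂ ↦
    hasCompactSupport_fun_sum fun m₃ _ ↦ ?_
  have e : (fun u : ℝ ↦ psi1 ((m₃ : ℝ) / M₃') * f (((m₁ : ℝ) * u + m₃) / m₂)) =
      fun u ↦ psi1 ((m₃ : ℝ) / M₃') * f (((m₁ : ℝ) / m₂) * u + (m₃ : ℝ) / m₂) := by
    ext u; congr 2; ring
  rw [e]
  have ha : (m₁ : ℝ) / m₂ ≠ 0 := div_ne_zero (by exact_mod_cast hI₁ m₁ hm₁) (by exact_mod_cast hI₂ m₂ hm₂)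
  exact (hasCompactSupport_comp_affine hfs ha _).mul_left

/-- `gfun` is continuous. [folklore] -/
theorem gfun_continuous (hf : ContDiff ℝ ∞ f) (I₁ I₂ : Finset ℤ) (M₃' : ℝ) (N₃ : ℕ) :
    Continuous (gfun f I₁ I₂ M₃' N₃) :=
  (gfun_contDiff hf I₁ I₂ M₃' N₃).continuous

/-- **Plancherel for `g`** (eq. (9.4)): `∫ g² = ∫ |ĝ|²` for the complexified `g`.
[cite: GuthMaynard2026, (9.4)] -/
theorem integral_gfun_sq_eq (hf : ContDiff ℝ ∞ f) (hfs : HasCompactSupport f) (I₁ I₂ : Finset ℤ)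
    (hI₁ : ∀ m ∈ I₁, m ≠ 0) (hI₂ : ∀ m ∈ I₂, m ≠ 0) (M₃' : ℝ) (N₃ : ℕ) :
    ∫ u, gfun f I₁ I₂ M₃' N₃ u ^ 2 = ∫ ξ, ‖𝓕 (fun u ↦ ((gfun f I₁ I₂ M₃' N₃ u : ℝ) : ℂ)) ξ‖ ^ 2 := by
  set gc : ℝ → ℂ := fun u ↦ ((gfun f I₁ I₂ M₃' N₃ u : ℝ) : ℂ) with hgc
  have hgc_smooth : ContDiff ℝ ∞ gc := Complex.ofRealCLM.contDiff.comp (gfun_contDiff hf I₁ I₂ M₃' N₃)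
  have hgc_supp : HasCompactSupport gc := (hasCompactSupport_gfun hfs I₁ I₂ hI₁ hI₂ M₃' N₃).comp_left Complex.ofReal_zero
  set S : SchwartzMap ℝ ℂ := hgc_supp.toSchwartzMap hgc_smooth with hS
  have h := SchwartzMap.integral_norm_sq_fourier S
  have e1 : (S : ℝ → ℂ) = gc := rfl
  rw [SchwartzMap.fourier_coe, e1] at h
  rw [h]
  refine integral_congr_ae (Eventually.of_forall fun u ↦ ?_)
  simp only [hgc, Complex.norm_real, Real.norm_eq_abs, sq_abs]

end smooth

/-! ## §3. The Fourier transform of `g` and its majorants (eqs. (9.5), (9.6)) -/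

/-- `P_{m₁}(ξ) = ∑_{|m₃| ≤ N₃} ψ₁(m₃/M₃') e(m₃ξ/m₁)`. [cite: GuthMaynard2026, (9.5)] -/
def Pfun (M₃' : ℝ) (N₃ : ℕ) (m₁ : ℤ) (ξ : ℝ) : ℂ :=
  ∑ m₃ ∈ Finset.Icc (-(N₃ : ℤ)) N₃, ((psi1 ((m₃ : ℝ) / M₃') : ℝ) : ℂ) * ech ((m₃ : ℝ) * (ξ / m₁))

/-- `Φ_{m₁}(ξ) = |∑_{m₂∈I₂} |m₂/m₁| f̂(m₂ξ/m₁)|`. [cite: GuthMaynard2026, (9.6)] -/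
def Phifun (f : ℝ → ℝ) (I₂ : Finset ℤ) (m₁ : ℤ) (ξ : ℝ) : ℝ :=
  ‖∑ m₂ ∈ I₂, ((|(m₂ : ℝ) / m₁| : ℝ) : ℂ) * 𝓕 (fun x ↦ ((f x : ℝ) : ℂ)) ((m₂ : ℝ) * ξ / m₁)‖

section fourier

variable {f : ℝ → ℝ} (hf : ContDiff ℝ ∞ f) (hfs : HasCompactSupport f)

/-- The Fourier transform of one term: `𝓕[u ↦ ψ₁(m₃/M₃') f((m₁u+m₃)/m₂)](ξ) =
ψ₁(m₃/M₃') |m₂/m₁| e(m₃ξ/m₁) f̂(m₂ξ/m₁)` (`m₁, m₂ ≠ 0`). [cite: GuthMaynard2026, proof of Lemma 9.2] -/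
theorem fourier_term (M₃' : ℝ) {m₁ m₂ : ℤ} (hm₁ : m₁ ≠ 0) (hm₂ : m₂ ≠ 0) (m₃ : ℤ) (ξ : ℝ) :
    𝓕 (fun u ↦ ((psi1 ((m₃ : ℝ) / M₃') * f (((m₁ : ℝ) * u + m₃) / m₂) : ℝ) : ℂ)) ξ =
      ((psi1 ((m₃ : ℝ) / M₃') : ℝ) : ℂ) * (((|(m₂ : ℝ) / m₁| : ℝ) : ℂ) * ech ((m₃ : ℝ) * (ξ / m₁)) *
        𝓕 (fun x ↦ ((f x : ℝ) : ℂ)) ((m₂ : ℝ) * ξ / m₁)) := by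
  have hm₁' : (m₁ : ℝ) ≠ 0 := by exact_mod_cast hm₁
  have hm₂' : (m₂ : ℝ) ≠ 0 := by exact_mod_cast hm₂
  have ha : (m₁ : ℝ) / m₂ ≠ 0 := div_ne_zero hm₁' hm₂'
  have e : (fun u ↦ ((psi1 ((m₃ : ℝ) / M₃') * f (((m₁ : ℝ) * u + m₃) / m₂) : ℝ) : ℂ)) =
      fun u ↦ ((psi1 ((m₃ : ℝ) / M₃') : ℝ) : ℂ) * (fun y ↦ ((f y : ℝ) : ℂ)) (((m₁ : ℝ) / m₂) * u + (m₃ : ℝ) / m₂) := by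
    ext u
    have : ((m₁ : ℝ) * u + m₃) / m₂ = ((m₁ : ℝ) / m₂) * u + (m₃ : ℝ) / m₂ := by
      field_simp
    rw [this, Complex.ofReal_mul]
  have h1 : (|(m₁ : ℝ) / m₂|⁻¹ : ℝ) = |(m₂ : ℝ) / m₁| := by rw [abs_div, abs_div, inv_div]
  have h2 : (m₃ : ℝ) / m₂ * ξ / ((m₁ : ℝ) / m₂) = (m₃ : ℝ) * (ξ / m₁) := by
    field_simp
  have h3 : ξ / ((m₁ : ℝ) / m₂) = (m₂ : ℝ) * ξ / m₁ := by
    field_simp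
  rw [e, fourier_const_mul, fourier_comp_affine (fun y ↦ ((f y : ℝ) : ℂ)) ha, h1, h2, h3]

include hf hfs

/-- **Eq. (9.5): the formula for `ĝ`**:
`ĝ(ξ) = ∑_{m₁∈I₁} ∑_{m₂∈I₂} |m₂/m₁| f̂(m₂ξ/m₁) P_{m₁}(ξ)` (all `m₁, m₂` non-zero). [cite: GuthMaynard2026, (9.5)] -/
theorem fourier_gfun_eq (I₁ I₂ : Finset ℤ) (hI₁ : ∀ m ∈ I₁, m ≠ 0) (hI₂ : ∀ m ∈ I₂, m ≠ 0)
    (M₃' : ℝ) (N₃ : ℕ) (ξ : ℝ) :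
    𝓕 (fun u ↦ ((gfun f I₁ I₂ M₃' N₃ u : ℝ) : ℂ)) ξ =
      ∑ m₁ ∈ I₁, (∑ m₂ ∈ I₂, ((|(m₂ : ℝ) / m₁| : ℝ) : ℂ) * 𝓕 (fun x ↦ ((f x : ℝ) : ℂ)) ((m₂ : ℝ) * ξ / m₁)) *
        Pfun M₃' N₃ m₁ ξ := by
  -- integrability of each term
  have hint : ∀ m₁ ∈ I₁, ∀ m₂ ∈ I₂, ∀ m₃ : ℤ, Integrable (fun u ↦ ech (-(u * ξ)) *
      ((psi1 ((m₃ : ℝ) / M₃') * f (((m₁ : ℝ) * u + m₃) / m₂) : ℝ) : ℂ)) := by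
    intro m₁ hm₁ m₂ hm₂ m₃
    have e : (fun u : ℝ ↦ psi1 ((m₃ : ℝ) / M₃') * f (((m₁ : ℝ) * u + m₃) / m₂)) =
        fun u ↦ psi1 ((m₃ : ℝ) / M₃') * f (((m₁ : ℝ) / m₂) * u + (m₃ : ℝ) / m₂) := by
      ext u; congr 2; field_simp
    have ha : (m₁ : ℝ) / m₂ ≠ 0 := div_ne_zero (by exact_mod_cast hI₁ m₁ hm₁) (by exact_mod_cast hI₂ m₂ hm₂)
    have hc : Continuous (fun u : ℝ ↦ psi1 ((m₃ : ℝ) / M₃') * f (((m₁ : ℝ) * u + m₃) / m₂)) := by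
      rw [e]; exact continuous_const.mul ((contDiff_comp_affine hf _ _).continuous)
    have hs : HasCompactSupport (fun u : ℝ ↦ psi1 ((m₃ : ℝ) / M₃') * f (((m₁ : ℝ) * u + m₃) / m₂)) := by
      rw [e]; exact (hasCompactSupport_comp_affine hfs ha _).mul_left
    have h1 : Integrable (fun u : ℝ ↦ ((psi1 ((m₃ : ℝ) / M₃') * f (((m₁ : ℝ) * u + m₃) / m₂) : ℝ) : ℂ)) :=
      (hc.integrable_of_hasCompactSupport hs).ofReal
    exact h1.bdd_mul (continuous_ech.comp (by fun_prop)).aestronglyMeasurable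
      (Eventually.of_forall fun u ↦ (norm_ech _).le)
  rw [fourier_eq_integral_ech]
  have e0 : ∀ u, ech (-(u * ξ)) * ((gfun f I₁ I₂ M₃' N₃ u : ℝ) : ℂ) =
      ∑ m₁ ∈ I₁, ∑ m₂ ∈ I₂, ∑ m₃ ∈ Finset.Icc (-(N₃ : ℤ)) N₃,
        ech (-(u * ξ)) * ((psi1 ((m₃ : ℝ) / M₃') * f (((m₁ : ℝ) * u + m₃) / m₂) : ℝ) : ℂ) := by
    intro u
    simp only [gfun]
    push_cast
    simp only [Finset.mul_sum]
  simp_rw [e0]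
  rw [integral_finsetSum _ (fun m₁ hm₁ ↦ integrable_finsetSum _ fun m₂ hm₂ ↦ integrable_finsetSum _ fun m₃ _ ↦ hint m₁ hm₁ m₂ hm₂ m₃)]
  refine Finset.sum_congr rfl fun m₁ hm₁ ↦ ?_
  rw [integral_finsetSum _ (fun m₂ hm₂ ↦ integrable_finsetSum _ fun m₃ _ ↦ hint m₁ hm₁ m₂ hm₂ m₃), Finset.sum_mul]
  refine Finset.sum_congr rfl fun m₂ hm₂ ↦ ?_
  rw [integral_finsetSum _ (fun m₃ _ ↦ hint m₁ hm₁ m₂ hm₂ m₃), Pfun, Finset.mul_sum]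
  refine Finset.sum_congr rfl fun m₃ _ ↦ ?_
  rw [← fourier_eq_integral_ech, fourier_term M₃' (hI₁ m₁ hm₁) (hI₂ m₂ hm₂) m₃ ξ]
  ring

end fourier

/-- **Poisson summation for `P_{m₁}`**: `P_{m₁}(ξ) = ∑_ℓ M₃' ψ̂₁(M₃'(ℓ − ξ/m₁))` when `M₃' > 0` and
`N₃ ≥ 3M₃'`, whence **`|P_{m₁}(ξ)| ≤ perK ψ̂₁ M₃' (ξ/m₁)`**. [cite: GuthMaynard2026, (9.5)–(9.6)] -/
theorem norm_Pfun_le {M₃' : ℝ} (hM₃' : 0 < M₃') {N₃ : ℕ} (hN₃ : 3 * M₃' ≤ N₃) (m₁ : ℤ) (ξ : ℝ) :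
    ‖Pfun M₃' N₃ m₁ ξ‖ ≤ perK (𝓕 (fun x ↦ ((psi1 x : ℝ) : ℂ))) M₃' (ξ / m₁) := by
  set ψc : ℝ → ℂ := fun x ↦ ((psi1 x : ℝ) : ℂ) with hψc
  have hψ : ContDiff ℝ ∞ ψc := Complex.ofRealCLM.contDiff.comp psi1_contDiff
  have hψs : HasCompactSupport ψc := psi1_hasCompactSupport.comp_left Complex.ofReal_zero
  have hψ3 : ∀ y, 3 ≤ |y| → ψc y = 0 := by
    intro y hy
    simp only [hψc]
    have : psi1 y = 0 := by
      by_contra h; have := abs_lt_of_psi1_ne_zero h; linarith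
    rw [this]; simp
  obtain ⟨hsum, hP⟩ := tsum_bump_modulate_eq hψ hψs hM₃' (ξ / m₁)
  have h1 : Pfun M₃' N₃ m₁ ξ = ∑' n : ℤ, ψc (n / M₃') * ech (n * (ξ / m₁)) := by
    rw [tsum_bump_modulate_eq_sum hψ3 hM₃' (ξ / m₁) N₃ hN₃, Pfun]
  rw [h1, hP]
  have hsum' : Summable (fun ℓ : ℤ ↦ ‖(M₃' : ℂ) * 𝓕 ψc (M₃' * (ℓ - ξ / m₁))‖) := hsum.norm
  refine (norm_tsum_le_tsum_norm hsum').trans (le_of_eq ?_)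
  rw [perK]
  refine tsum_congr fun ℓ ↦ ?_
  rw [norm_mul, Complex.norm_real, Real.norm_of_nonneg hM₃'.le]

section majorant

variable {f : ℝ → ℝ} (hf : ContDiff ℝ ∞ f) (hfs : HasCompactSupport f)
include hf hfs

/-- **Eq. (9.6)**: `|ĝ(ξ)| ≤ ∑_{m₁∈I₁} perK ψ̂₁ M₃' (ξ/m₁) · Φ_{m₁}(ξ)`. [cite: GuthMaynard2026, (9.6)] -/
theorem norm_fourier_gfun_le (I₁ I₂ : Finset ℤ) (hI₁ : ∀ m ∈ I₁, m ≠ 0) (hI₂ : ∀ m ∈ I₂, m ≠ 0)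
    {M₃' : ℝ} (hM₃' : 0 < M₃') {N₃ : ℕ} (hN₃ : 3 * M₃' ≤ N₃) (ξ : ℝ) :
    ‖𝓕 (fun u ↦ ((gfun f I₁ I₂ M₃' N₃ u : ℝ) : ℂ)) ξ‖ ≤
      ∑ m₁ ∈ I₁, perK (𝓕 (fun x ↦ ((psi1 x : ℝ) : ℂ))) M₃' (ξ / m₁) * Phifun f I₂ m₁ ξ := by
  rw [fourier_gfun_eq hf hfs I₁ I₂ hI₁ hI₂ M₃' N₃ ξ]
  refine (norm_sum_le _ _).trans (Finset.sum_le_sum fun m₁ _ ↦ ?_)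
  rw [norm_mul, Phifun, mul_comm]
  exact mul_le_mul_of_nonneg_right (norm_Pfun_le hM₃' hN₃ m₁ ξ) (norm_nonneg _)

omit hf hfs in
/-- Cauchy–Schwarz: `(∑ aᵢbᵢ)² ≤ (∑ aᵢ)(∑ aᵢbᵢ²)` for `aᵢ ≥ 0`. [folklore] -/
theorem sq_sum_mul_le {ι : Type*} (s : Finset ι) (a b : ι → ℝ) (ha : ∀ i ∈ s, 0 ≤ a i) :
    (∑ i ∈ s, a i * b i) ^ 2 ≤ (∑ i ∈ s, a i) * ∑ i ∈ s, a i * b i ^ 2 := by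
  have h := Finset.sum_mul_sq_le_sq_mul_sq s (fun i ↦ Real.sqrt (a i)) (fun i ↦ Real.sqrt (a i) * b i)
  have e1 : ∀ i ∈ s, Real.sqrt (a i) * (Real.sqrt (a i) * b i) = a i * b i := by
    intro i hi; rw [← mul_assoc, Real.mul_self_sqrt (ha i hi)]
  have e2 : ∀ i ∈ s, Real.sqrt (a i) ^ 2 = a i := fun i hi ↦ Real.sq_sqrt (ha i hi)
  have e3 : ∀ i ∈ s, (Real.sqrt (a i) * b i) ^ 2 = a i * b i ^ 2 := by
    intro i hi; rw [mul_pow, Real.sq_sqrt (ha i hi)]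
  rw [Finset.sum_congr rfl e1, Finset.sum_congr rfl e2, Finset.sum_congr rfl e3] at h
  exact h

/-- **`|ĝ(ξ)|² ≤ S(ξ) · ∑_{m₁} perK(ξ/m₁) Φ_{m₁}(ξ)²`** with `S(ξ) = ∑_{m₁} perK(ξ/m₁)` ("we can use
Cauchy–Schwarz in (9.6)"). [cite: GuthMaynard2026, proof of Lemma 9.2] -/
theorem normSq_fourier_gfun_le (I₁ I₂ : Finset ℤ) (hI₁ : ∀ m ∈ I₁, m ≠ 0) (hI₂ : ∀ m ∈ I₂, m ≠ 0)
    {M₃' : ℝ} (hM₃' : 0 < M₃') {N₃ : ℕ} (hN₃ : 3 * M₃' ≤ N₃) (ξ : ℝ) :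
    ‖𝓕 (fun u ↦ ((gfun f I₁ I₂ M₃' N₃ u : ℝ) : ℂ)) ξ‖ ^ 2 ≤
      (∑ m₁ ∈ I₁, perK (𝓕 (fun x ↦ ((psi1 x : ℝ) : ℂ))) M₃' (ξ / m₁)) *
        ∑ m₁ ∈ I₁, perK (𝓕 (fun x ↦ ((psi1 x : ℝ) : ℂ))) M₃' (ξ / m₁) * Phifun f I₂ m₁ ξ ^ 2 := by
  have h1 := norm_fourier_gfun_le hf hfs I₁ I₂ hI₁ hI₂ hM₃' hN₃ ξ
  have h0 : 0 ≤ ∑ m₁ ∈ I₁, perK (𝓕 (fun x ↦ ((psi1 x : ℝ) : ℂ))) M₃' (ξ / m₁) * Phifun f I₂ m₁ ξ :=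
    Finset.sum_nonneg fun m₁ _ ↦ mul_nonneg (perK_nonneg _ hM₃'.le _) (norm_nonneg _)
  calc ‖𝓕 (fun u ↦ ((gfun f I₁ I₂ M₃' N₃ u : ℝ) : ℂ)) ξ‖ ^ 2
      ≤ (∑ m₁ ∈ I₁, perK (𝓕 (fun x ↦ ((psi1 x : ℝ) : ℂ))) M₃' (ξ / m₁) * Phifun f I₂ m₁ ξ) ^ 2 :=
        pow_le_pow_left₀ (norm_nonneg _) h1 2
    _ ≤ _ := sq_sum_mul_le I₁ _ _ fun m₁ _ ↦ perK_nonneg _ hM₃'.le _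

end majorant

end GuthMaynardAffine

end Literature.NumberTheory.LFunctions

end
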